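import Summits.CriticalPhenomena.SAWScalingLimit.Theorems.SAWLeftRightFKGLeftRightFKGDefs
import Summits.CriticalPhenomena.SAWScalingLimit.Theorems.SAWLeftRightFKGLeftRightFKGStubMeshReduction
import Summits.CriticalPhenomena.SAWScalingLimit.Theorems.SAWLeftRightFKGLeftRightFKGStubLoopWindVanish
import Summits.CriticalPhenomena.SAWScalingLimit.Theorems.SAWLeftRightFKGLeftRightFKGStubStepMonotoneAux1
import Summits.CriticalPhenomena.SAWScalingLimit.Theorems.LeftRightFKG.Negative.OrderCharacterisation
import HarnessLib

/-!
# Stub `stub_stepMonotone` of line `corner-localisation`, helper file 2: class-constancy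

Crux `LeftRightFKG` (stmt-CriticalPhenomena-11232), vocabulary module
`Summits.CriticalPhenomena.SAWScalingLimit.Theorems.SAWLeftRightFKGLeftRightFKGDefs`.

Plane topology of lattice polylines (winding numbers of a closed lattice walk are constant along
lattice chains off its vertex set, and from a face centre to a free corner of the face), the
combinatorics of prefix classes of chords (two distinct chords agreeing up to position `k` both
have length `> k`), the reversal symmetry of the left–right order, and the main consequence
`wind_lens_probeL_eq_zero`: for two chords of `(C, 1)` sharing their first `k + 1` vertices, the
lens loop `γ₁ · γ₂⁻¹` has winding number `0` about the centres of the faces at the reference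
neighbour `p'` (`= a'` for `k = 0`, `= γᵢ(k-1)` for `k ≥ 1`) — the input `LoopWindVanish` enters
here, at the point `pt a'` of the boundary trace.
-/

noncomputable section

open Set Complex Literature.Probability.LatticeModels Literature.Probability.RandomPlanarGeometry
open Literature.Topology.PlaneTopology
open Summit.CriticalPhenomena.SAWScalingLimit.Theorems.LeftRightFKG.Negative

namespace Summit.CriticalPhenomena.SAWScalingLimit.Theorems.LeftRightFKG.CornerLoc

namespace StepMono

/-! ## Lattice polylines off the vertex set of a closed walk -/

/-- `pt` is injective. [folklore] -/
theorem pt_inj {x y : Site 2} (h : pt x = pt y) : x = y := by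
  have h0 := congrArg Complex.re h
  have h1 := congrArg Complex.im h
  simp only [pt_re, pt_im, Int.cast_inj] at h0 h1
  rw [eq_bx x, eq_bx y, h0, h1]

/-- A lattice point on a lattice polyline is one of its vertices. [folklore] -/
theorem mem_of_pt_mem_range_poly {x : Site 2} :
    ∀ (a : Site 2) (l : List (Site 2)), List.IsChain (zdGraph 2).Adj (a :: l) →
      pt x ∈ range (poly a l) → x ∈ a :: l
  | a, [], _, hx => by
    obtain ⟨t, ht⟩ := hx
    have hta : (poly a []) t = pt a := rfl
    have : pt x = pt a := by rw [← ht, hta]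
    simp [pt_inj this]
  | a, b :: l, hc, hx => by
    rw [range_poly_cons] at hx
    rw [List.isChain_cons_cons] at hc
    rcases hx with hx | hx
    · rcases pt_eq_of_mem_segment hc.1 hx with h | h
      · simp [pt_inj h]
      · simp [pt_inj h]
    · exact List.mem_cons_of_mem _ (mem_of_pt_mem_range_poly b l hc.2 hx)

/-- A lattice polyline whose vertices avoid the vertex set of a second lattice polyline misses it
(two unit lattice segments that meet share an endpoint lying on both). [folklore] -/
theorem range_poly_subset_compl {u : Site 2} {L : List (Site 2)}
    (hL : List.IsChain (zdGraph 2).Adj (u :: L)) :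
    ∀ (a : Site 2) (l : List (Site 2)), List.IsChain (zdGraph 2).Adj (a :: l) →
      (∀ x ∈ a :: l, x ∉ u :: L) → range (poly a l) ⊆ (range (poly u L))ᶜ
  | a, [], _, hd => by
    rintro _ ⟨t, rfl⟩ hmem
    have hta : (poly a []) t = pt a := rfl
    rw [hta] at hmem
    exact hd a (by simp) (mem_of_pt_mem_range_poly u L hL hmem)
  | a, b :: l, hc, hd => by
    rw [List.isChain_cons_cons] at hc
    rw [range_poly_cons]
    refine union_subset ?_
      (range_poly_subset_compl hL b l hc.2 fun x hx => hd x (List.mem_cons_of_mem _ hx))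
    exact (disjoint_segment_range_poly hc.1 u L hL
      (fun h => hd a (by simp) (mem_of_pt_mem_range_poly u L hL h))
      (fun h => hd b (by simp) (mem_of_pt_mem_range_poly u L hL h))).subset_compl_right

variable {G : SimpleGraph (Site 2)}

/-- **Winding numbers of a closed walk are constant along lattice chains off its vertex set.**
[folklore] -/
theorem wind_loop_eq_of_chain (hG : ∀ x y, G.Adj x y → (zdGraph 2).Adj x y) {u : Site 2}
    (R : G.Walk u u) (a : Site 2) (l : List (Site 2)) (hc : List.IsChain (zdGraph 2).Adj (a :: l))
    (hd : ∀ x ∈ a :: l, x ∉ R.support) {x : Site 2} (hx : x ∈ a :: l) :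
    wind (fun t : ℝ => IccExtend zero_le_one (R.toCurve (meshPoint 1)) t - pt a) =
      wind (fun t : ℝ => IccExtend zero_le_one (R.toCurve (meshPoint 1)) t - pt x) := by
  simp only [iccExtend_toCurve_apply]
  set P := poly u R.support.tail with hP
  have hchain : List.IsChain (zdGraph 2).Adj (u :: R.support.tail) := isChain_support hG R
  have hd' : ∀ y ∈ a :: l, y ∉ u :: R.support.tail := by
    rw [R.cons_tail_support]
    exact hd
  have hsub : range (poly a l) ⊆ (range P)ᶜ := range_poly_subset_compl hchain a l hc hd'
  have hxr : pt x ∈ range (poly a l) :=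
    mem_range_polylineFrom (pt a) (l.map pt) (by rw [← List.map_cons]; exact List.mem_map_of_mem hx)
  have hcc : pt x ∈ connectedComponentIn (range P)ᶜ (pt a) :=
    (isPreconnected_range (poly a l).continuous).subset_connectedComponentIn
      ⟨0, (poly a l).source⟩ hsub hxr
  have h01 : P.extend 0 = P.extend 1 := by
    rw [Path.extend_zero, Path.extend_one, poly_fst_walk R]
  exact wind_sub_eq_of_mem_connectedComponentIn P.continuous_extend.continuousOn h01
    (isCompact_range P.continuous).isClosed
    (fun t ht => by rw [Path.extend_apply P ht]; exact ⟨_, rfl⟩) hcc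

/-- **From a face centre to a free corner.** If the site `q` is a corner of the face `(m, k)` and
not a vertex of the closed walk `R`, the winding numbers of `R` about the face centre and about
`pt q` agree (the open segment between them lies in the open face, off every lattice polyline).
[folklore] -/
theorem wind_loop_probeL_eq_corner (hG : ∀ x y, G.Adj x y → (zdGraph 2).Adj x y) {u : Site 2}
    (R : G.Walk u u) {q : Site 2} (hq : q ∉ R.support) {m k : ℤ}
    (h0 : q 0 = m ∨ q 0 = m + 1) (h1 : q 1 = k ∨ q 1 = k + 1) :
    wind (fun t : ℝ => IccExtend zero_le_one (R.toCurve (meshPoint 1)) t - probeL m k) =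
      wind (fun t : ℝ => IccExtend zero_le_one (R.toCurve (meshPoint 1)) t - pt q) := by
  simp only [iccExtend_toCurve_apply]
  set P := poly u R.support.tail with hP
  have hchain : List.IsChain (zdGraph 2).Adj (u :: R.support.tail) := isChain_support hG R
  have hqP : pt q ∉ range P := fun h =>
    hq (by rw [← R.cons_tail_support]; exact mem_of_pt_mem_range_poly u _ hchain h)
  have hre : (m : ℝ) ≤ (pt q).re ∧ (pt q).re ≤ m + 1 := by
    rw [pt_re]
    rcases h0 with h | h <;> rw [h] <;> push_cast <;> constructor <;> linarith
  have him : (k : ℝ) ≤ (pt q).im ∧ (pt q).im ≤ k + 1 := by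
    rw [pt_im]
    rcases h1 with h | h <;> rw [h] <;> push_cast <;> constructor <;> linarith
  have hseg : segment ℝ (pt q) (probeL m k) ⊆ (range P)ᶜ := by
    rw [← insert_endpoints_openSegment]
    rintro y (rfl | rfl | hy)
    · exact hqP
    · exact probeL_not_mem_range_poly m k hchain
    · intro hyP
      exact not_int_of_mem_openFace (openSegment_subset_openFace hre.1 hre.2 him.1 him.2 hy)
        (exists_int_of_mem_range_poly u _ hchain y hyP)
  have hcc : probeL m k ∈ connectedComponentIn (range P)ᶜ (pt q) :=
    (convex_segment _ _).isPreconnected.subset_connectedComponentIn (left_mem_segment _ _ _) hseg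
      (right_mem_segment _ _ _)
  have h01 : P.extend 0 = P.extend 1 := by
    rw [Path.extend_zero, Path.extend_one, poly_fst_walk R]
  exact (wind_sub_eq_of_mem_connectedComponentIn P.continuous_extend.continuousOn h01
    (isCompact_range P.continuous).isClosed
    (fun t ht => by rw [Path.extend_apply P ht]; exact ⟨_, rfl⟩) hcc).symm

/-- In a path, the vertices before position `k` are not vertices of the tail from position `k`.
[folklore] -/
theorem getVert_not_mem_support_drop {a b : Site 2} {γ : G.Walk a b} (hγ : γ.IsPath) {i k : ℕ}
    (hik : i < k) (hk : k ≤ γ.length) : γ.getVert i ∉ (γ.drop k).support := by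
  intro h
  rw [SimpleGraph.Walk.mem_support_iff_exists_getVert] at h
  obtain ⟨n, hn, hnl⟩ := h
  rw [SimpleGraph.Walk.drop_getVert] at hn
  rw [SimpleGraph.Walk.drop_length] at hnl
  have := hγ.getVert_injOn (by simp only [Set.mem_setOf_eq]; omega)
    (by simp only [Set.mem_setOf_eq]; omega) hn
  omega

/-- `getVert` only depends on the support (and the final vertex). [folklore] -/
theorem getVert_eq_of_support_eq {G' : SimpleGraph (Site 2)} {u v u' : Site 2}
    (w : G.Walk u v) (w' : G'.Walk u' v) (h : w.support = w'.support) (i : ℕ) :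
    w.getVert i = w'.getVert i := by
  rw [SimpleGraph.Walk.getVert_eq_getD_support, SimpleGraph.Walk.getVert_eq_getD_support, h]

/-- A bounding box for a finite list of sites. [folklore] -/
theorem exists_box (l : List (Site 2)) : ∃ X0 X1 Y0 Y1 : ℤ,
    ∀ x ∈ l, (X0 ≤ x 0 ∧ x 0 ≤ X1) ∧ (Y0 ≤ x 1 ∧ x 1 ≤ Y1) := by
  induction l with
  | nil => exact ⟨0, 0, 0, 0, fun x hx => by simp at hx⟩
  | cons a l ih =>
    obtain ⟨X0, X1, Y0, Y1, h⟩ := ih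
    refine ⟨min X0 (a 0), max X1 (a 0), min Y0 (a 1), max Y1 (a 1), fun x hx => ?_⟩
    rcases List.mem_cons.1 hx with rfl | hx
    · exact ⟨⟨min_le_right _ _, le_max_right _ _⟩, min_le_right _ _, le_max_right _ _⟩
    · obtain ⟨⟨h1, h2⟩, h3, h4⟩ := h x hx
      exact ⟨⟨(min_le_left _ _).trans h1, h2.trans (le_max_left _ _)⟩,
        (min_le_left _ _).trans h3, h4.trans (le_max_left _ _)⟩

/-! ## Chords of the crux instance at mesh `1` -/

/-- Vertices of the boundary walk are off the domain (junk index `0` on the trace). [folklore] -/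
theorem not_mem_dom_of_mem_support {c : Site 2} (C : (zdGraph 2).Walk c c) {x : Site 2}
    (hx : x ∈ C.support) : pt x ∉ dom C 1 := by
  simp only [dom, mem_setOf_eq, not_not, iccExtend_toCurve_apply]
  apply wind_eq_zero_of_mem_range
  have hmem : pt x ∈ pt c :: C.support.tail.map pt := by
    rw [← List.map_cons, C.cons_tail_support]
    exact List.mem_map_of_mem hx
  exact mem_range_polylineFrom _ _ hmem

/-- A site off the domain other than the initial vertex is not a vertex of a walk of `Ω_1`.
[folklore] -/
theorem not_mem_support_of_not_mem_dom {c : Site 2} (C : (zdGraph 2).Walk c c) {a b q : Site 2}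
    (w : (discreteDomainGraph (dom C 1) 1).Walk a b) (hq : pt q ∉ dom C 1) (hqa : q ≠ a) :
    q ∉ w.support := fun h => by
  rcases support_subset_of_walk w q h with h | h
  · exact hqa h
  · have h' := meshDomain_subset_meshVertices _ _ h
    rw [mem_meshVertices_iff, meshPoint_one] at h'
    exact hq h'

/-- The lattice graph `Ω_1` is a lattice subgraph. [folklore] -/
theorem adj_of_adj {c : Site 2} (C : (zdGraph 2).Walk c c) :
    ∀ x y, (discreteDomainGraph (dom C 1) 1).Adj x y → (zdGraph 2).Adj x y :=
  fun _ _ hxy => meshGraph_le_zdGraph _ _ (discreteDomainGraph_le_meshGraph _ _ hxy)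

/-- **Two distinct chords agreeing up to position `k` both have length `> k`** (a path visits `b`
only at its end, and two chords with the same vertex sequence are equal). [folklore] -/
theorem lt_length_of_ne {Ω : Set ℂ} {δ : ℝ} {a b : Site 2} {γ₁ γ₂ : SAW.DomainSAW Ω δ a b}
    {k : ℕ} {π : ℕ → Site 2} (h₁ : AgreeTo k π γ₁) (h₂ : AgreeTo k π γ₂) (hne : γ₁ ≠ γ₂) :
    k < γ₁.walk.length := by
  by_contra hk
  push Not at hk
  have hπ : ∀ i ≤ k, γ₁.walk.getVert i = γ₂.walk.getVert i := fun i hi => by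
    rw [h₁ i hi, h₂ i hi]
  have hb : γ₂.walk.getVert γ₁.walk.length = b := by
    rw [← hπ _ hk, SimpleGraph.Walk.getVert_length]
  have hlen : γ₂.walk.length = γ₁.walk.length := by
    rcases le_total γ₁.walk.length γ₂.walk.length with h | h
    · exact ((γ₂.isPath.getVert_eq_end_iff h).1 hb).symm
    · have hb' : γ₁.walk.getVert γ₂.walk.length = b := by
        rw [hπ _ (h.trans hk), SimpleGraph.Walk.getVert_length]
      exact (γ₁.isPath.getVert_eq_end_iff h).1 hb'
  have hw : γ₁.walk = γ₂.walk := by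
    refine SimpleGraph.Walk.ext_getVert fun i => ?_
    rcases le_or_gt i k with hi | hi
    · exact hπ i hi
    · rw [SimpleGraph.Walk.getVert_of_length_le _ (by omega),
        SimpleGraph.Walk.getVert_of_length_le _ (by omega)]
  exact hne (domainSAW_eq_of_support_eq (by rw [hw]))

/-- **The left–right order under reversal of chords** (mesh `1`): if `γ₁ ≼ γ₂` then `γ₂⁻¹ ≼ γ₁⁻¹`
as chords from `b` to `a` — both say `wcross γ₁ ≤ wcross γ₂` facewise (`wind_nonneg_iff_wcross`).
[folklore] -/
theorem lr_reverse {c : Site 2} (C : (zdGraph 2).Walk c c) {a b : Site 2}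
    (γ₁ γ₂ : SAW.DomainSAW (dom C 1) 1 a b) (h : lr γ₁ γ₂) :
    lr (⟨γ₂.walk.reverse, γ₂.isPath.reverse⟩ : SAW.DomainSAW (dom C 1) 1 b a)
      ⟨γ₁.walk.reverse, γ₁.isPath.reverse⟩ := by
  have hG := adj_of_adj C
  obtain ⟨X0, X1, Y0, Y1, hbox⟩ := exists_box (γ₁.walk.support ++ γ₂.walk.support)
  have hb₁ : ∀ x ∈ γ₁.walk.support, (X0 ≤ x 0 ∧ x 0 ≤ X1) ∧ (Y0 ≤ x 1 ∧ x 1 ≤ Y1) :=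
    fun x hx => hbox x (List.mem_append_left _ hx)
  have hb₂ : ∀ x ∈ γ₂.walk.support, (X0 ≤ x 0 ∧ x 0 ≤ X1) ∧ (Y0 ≤ x 1 ∧ x 1 ≤ Y1) :=
    fun x hx => hbox x (List.mem_append_right _ hx)
  have h' := (wind_nonneg_iff_wcross hG γ₁.walk γ₂.walk hb₁ hb₂).1 h
  refine (wind_nonneg_iff_wcross hG γ₂.walk.reverse γ₁.walk.reverse (X0 := X0) (X1 := X1)
    (Y0 := Y0) (Y1 := Y1) ?_ ?_).2 ?_
  · intro x hx
    rw [SimpleGraph.Walk.support_reverse, List.mem_reverse] at hx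
    exact hb₂ x hx
  · intro x hx
    rw [SimpleGraph.Walk.support_reverse, List.mem_reverse] at hx
    exact hb₁ x hx
  · intro m k hm1 hm2 hk1 hk2
    rw [wcross_reverse, wcross_reverse]
    have := h' m k hm1 hm2 hk1 hk2
    omega

/-- **CLASS-CONSTANCY OF THE LENS WINDING AT THE FACES AROUND THE REFERENCE NEIGHBOUR.** For two
chords `γ₁`, `γ₂` of `(C, 1)` from `a` to `b` sharing their first `k + 1` vertices (`k <` both
lengths), with reference neighbour `p'` of `p = γᵢ(k)` (`p' = a'` — on the boundary walk, `a ∼ a'` —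
if `k = 0`, `p' = γᵢ(k-1)` if `k ≥ 1`), the lens `γ₁ · γ₂⁻¹` has winding number `0` about the centre
of every face having `p'` as a corner: it equals the winding number of the reduced lens
`R = γ₁[k..] · γ₂[k..]⁻¹` (`wind_lens_eq_wind_reduced`), whose base point is moved off `R` to
`pt p'` inside the face, then along the common prefix and the edge `[a, a']` to `pt a'`, where the
winding number vanishes (`LoopWindVanish`). [folklore] -/
theorem wind_lens_probeL_eq_zero (hL : LoopWindVanish) {c : Site 2} (C : (zdGraph 2).Walk c c)
    {a b a' : Site 2} (ha' : a' ∈ C.support) (haa' : (zdGraph 2).Adj a a')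
    (γ₁ γ₂ : SAW.DomainSAW (dom C 1) 1 a b) {k : ℕ}
    (hk : ∀ i ≤ k, γ₁.walk.getVert i = γ₂.walk.getVert i)
    (hk₁ : k < γ₁.walk.length) (hk₂ : k < γ₂.walk.length) {p' : Site 2}
    (hp'₀ : k = 0 → p' = a') (hp'₁ : 0 < k → p' = γ₁.walk.getVert (k - 1)) {m k' : ℤ}
    (h0 : p' 0 = m ∨ p' 0 = m + 1) (h1 : p' 1 = k' ∨ p' 1 = k' + 1) :
    wind (fun t : ℝ => IccExtend zero_le_one
      ((γ₁.walk.append γ₂.walk.reverse).toCurve (meshPoint 1)) t - probeL m k') = 0 := by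
  have hG := adj_of_adj C
  rw [wind_lens_eq_wind_reduced hG γ₁.walk γ₂.walk hk hk₁.le hk₂.le m k']
  set R := (γ₁.walk.drop k).append ((γ₂.walk.drop k).copy (hk k le_rfl).symm rfl).reverse
    with hR
  -- vertices of `R` are tail vertices of `γ₁` or of `γ₂`
  have hRsupp : ∀ x ∈ R.support,
      x ∈ (γ₁.walk.drop k).support ∨ x ∈ (γ₂.walk.drop k).support := by
    intro x hx
    rwa [hR, SimpleGraph.Walk.mem_support_append_iff, SimpleGraph.Walk.support_reverse,
      List.mem_reverse, SimpleGraph.Walk.support_copy] at hx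
  -- `a'` is not a vertex of any chord
  have ha'dom := not_mem_dom_of_mem_support C ha'
  have ha'R : a' ∉ R.support := fun h => by
    rcases hRsupp a' h with h | h
    · refine not_mem_support_of_not_mem_dom C γ₁.walk ha'dom haa'.ne.symm ?_
      rw [SimpleGraph.Walk.drop_support_eq_support_drop_min] at h
      exact List.mem_of_mem_drop h
    · refine not_mem_support_of_not_mem_dom C γ₂.walk ha'dom haa'.ne.symm ?_
      rw [SimpleGraph.Walk.drop_support_eq_support_drop_min] at h
      exact List.mem_of_mem_drop h
  -- the prefix vertices are not vertices of `R`
  have hpre : ∀ i < k, γ₁.walk.getVert i ∉ R.support := fun i hi h => by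
    rcases hRsupp _ h with h | h
    · exact getVert_not_mem_support_drop γ₁.isPath hi hk₁.le h
    · rw [hk i hi.le] at h
      exact getVert_not_mem_support_drop γ₂.isPath hi hk₂.le h
  have hp'R : p' ∉ R.support := by
    rcases Nat.eq_zero_or_pos k with rfl | hpos
    · rw [hp'₀ rfl]
      exact ha'R
    · rw [hp'₁ hpos]
      exact hpre (k - 1) (by omega)
  rw [wind_loop_probeL_eq_corner hG R hp'R h0 h1]
  -- from `pt p'` to `pt a'` along the common prefix
  have hpa : wind (fun t : ℝ => IccExtend zero_le_one (R.toCurve (meshPoint 1)) t - pt p') =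
      wind (fun t : ℝ => IccExtend zero_le_one (R.toCurve (meshPoint 1)) t - pt a') := by
    rcases Nat.eq_zero_or_pos k with rfl | hpos
    · rw [hp'₀ rfl]
    · rw [hp'₁ hpos]
      set Q := γ₁.walk.take (k - 1) with hQ
      have hQv : ∀ x ∈ Q.support, ∃ i < k, γ₁.walk.getVert i = x := fun x hx => by
        rw [SimpleGraph.Walk.mem_support_iff_exists_getVert] at hx
        obtain ⟨n, hn, -⟩ := hx
        rw [hQ, SimpleGraph.Walk.take_getVert] at hn
        exact ⟨min (k - 1) n, by omega, hn⟩
      have hc : List.IsChain (zdGraph 2).Adj (a' :: Q.support) := by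
        rw [← Q.cons_tail_support]
        exact List.isChain_cons_cons.2 ⟨haa'.symm, isChain_support hG Q⟩
      have hd : ∀ x ∈ a' :: Q.support, x ∉ R.support := by
        intro x hx
        rcases List.mem_cons.1 hx with rfl | hx
        · exact ha'R
        · obtain ⟨i, hi, rfl⟩ := hQv x hx
          exact hpre i hi
      have hmem : γ₁.walk.getVert (k - 1) ∈ a' :: Q.support :=
        List.mem_cons_of_mem _ Q.end_mem_support
      exact (wind_loop_eq_of_chain hG R a' Q.support hc hd hmem).symm
  rw [hpa]
  exact hL c _ C R (pt a') ha'dom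

end StepMono

/-- REGISTERED SUB-GOAL `stub_stepMonotoneAux2` of stub `stub_stepMonotone` (this helper file's main
theorem, recorded on the crux item so that the file lands as a `--supports` proof):
CLASS-CONSTANCY OF THE LENS WINDING — for two chords of `(C, 1)` from `a` to `b` sharing their
first `k + 1` vertices (`k <` both lengths) and the reference neighbour `p'` (`= a'` if `k = 0`,
`= γ₁ (k-1)` if `k ≥ 1`), the lens loop `γ₁ · γ₂⁻¹` has winding number `0` about the centre of
every face having `p'` as a corner, granted `LoopWindVanish`. [folklore] -/
theorem stub_stepMonotoneAux2 : LoopWindVanish → ∀ (c : Site 2) (C : (zdGraph 2).Walk c c)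
    (a b a' : Site 2), a' ∈ C.support → (zdGraph 2).Adj a a' →
    ∀ (γ₁ γ₂ : SAW.DomainSAW (dom C 1) 1 a b) (k : ℕ),
    (∀ i ≤ k, γ₁.walk.getVert i = γ₂.walk.getVert i) → k < γ₁.walk.length → k < γ₂.walk.length →
    ∀ (p' : Site 2), (k = 0 → p' = a') → (0 < k → p' = γ₁.walk.getVert (k - 1)) →
    ∀ (m k' : ℤ), (p' 0 = m ∨ p' 0 = m + 1) → (p' 1 = k' ∨ p' 1 = k' + 1) →
    wind (fun t : ℝ => Set.IccExtend zero_le_one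
      ((γ₁.walk.append γ₂.walk.reverse).toCurve (meshPoint 1)) t - Negative.probeL m k') = 0 :=
  fun hL _ C _ _ _ ha' haa' γ₁ γ₂ _ hk hk₁ hk₂ _ hp'₀ hp'₁ _ _ h0 h1 =>
    StepMono.wind_lens_probeL_eq_zero hL C ha' haa' γ₁ γ₂ hk hk₁ hk₂ hp'₀ hp'₁ h0 h1

end Summit.CriticalPhenomena.SAWScalingLimit.Theorems.LeftRightFKG.CornerLoc

end
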